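import Mathlib
import Summits.MatrixMultiplication.MatrixMultiplication.Theorems.HiddenToeplitzCornersHiddenCornerLemmaRHConst
import Summits.MatrixMultiplication.MatrixMultiplication.Theorems.HiddenToeplitzCornersHiddenCornerLemmaRStein
import Literature.LinearAlgebra.Matrix.FlandersTheorem

/-!
# Stub `stub_coreClassBound` (crux `HiddenCornerLemmaR`, stmt-MatrixMultiplication-10752,
# line `atkinson-lloyd-core-split`) — partial discharges and the obstruction

Support file for crux item `stmt-MatrixMultiplication-10752`
(`Summit.MatrixMultiplication.MatrixMultiplication.Theses.HiddenToeplitzCorners.HiddenCornerLemmaR`),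
line `atkinson-lloyd-core-split`, registered stub `stub_coreClassBound` (skeleton
`Cruxes/HiddenCornerLemmaR/Lines/atkinson_lloyd_core_split.lean`): a core-split pencil
`∇T a b = G₀ (H₁ a b)ᵀ + (G₁ a b) H₀ᵀ + Γ (C a b) Θᵀ` (`G₀ : N × p`, `H₀ : N × q`, `Γ : N × m₀`,
`Θ : N × n₀`, `rank C(X) ≤ ρ`, `2m₀, 2n₀ ≤ ρ(ρ+1)`) hiding a rank-`r` corner `T(X) E = F X`,
nonsingular somewhere and deep w.r.t. `[G₀ | Γ]`, should have `r ≤ 2(p + q + ρ)`.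

The stub itself is NOT proved here (it is open: see `leftConstBound_add_two_of_coreClassBound`).
What this file proves, sorry-free, each special case with the stub's exact binder list plus the
extra hypotheses named in front:

* `coreClassBound_p_zero_of_le` — `p = 0`, `n₀ ≤ 2ρ + q`: absorb the core into the right factor,
  `∇T a b = [G₁ a b | Γ C a b] · [H₀ | Θ]ᵀ`, and apply the landed H-constant lemma
  `hclR_hconst_bound` (`r ≤ q + n₀`).  Corollary `coreClassBound_p_zero_rho_le_three`
  (`p = 0`, `ρ ≤ 3`, Atkinson's size bound `2n₀ ≤ ρ(ρ+1) ≤ 4ρ`).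
* `core_pure_sq_le` — the RANK-AWARE count for pure cores (`p = q = 0`): `X ↦ C(X)` is injective
  (corner + `rank F = r` + Stein uniqueness), so `{C(X)}` is an `r²`-dimensional space of
  `m₀ × n₀` matrices of rank `≤ ρ`, and Flanders' theorem (tree:
  `Literature.LinearAlgebra.Matrix.finrank_le_of_forall_rank_le`) gives `r² ≤ ρ · max(m₀, n₀)`.
  With Atkinson's size bound this is `r² ≤ ρ²(ρ+1)/2 < (2ρ+1)²` for `ρ ≤ 8`:
  `coreClassBound_pq_zero_rho_le_eight` (`p = q = 0`, `ρ ≤ 8`; the H-constant count alone stops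
  at `ρ = 3`).  For `ρ ≥ 9` the two counts allow `(ρ, m₀, n₀, r) = (9, 45, 45, 20 > 18)`.
  Together: `coreClassBound_p_zero_budget_le_four` (`p = 0`, `q + ρ ≤ 4`: every core class without
  left border rows of displacement rank `d ≤ 4`); first open `p = 0` instance `(q, ρ, n₀) = (1, 4, 10)`.
* `leftConstBound_add_two_of_coreClassBound` — the OBSTRUCTION, machine-checked: the statement of
  the stub implies the statement of the neighbouring stub `stub_leftConstBound` (pure left-constant
  class) with conclusion `r ≤ 2p + 2` (take `q = 0`, `ρ = m₀ = n₀ = 1`, `C ≡ 0`, `Θ = e₀`,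
  `Γ =` a column outside the column span of `G₀` with nonzero entry `0`; the deep hypothesis is
  then vacuous).  So the stub is at least as hard as the G-constant law up to `+2`, open already at
  `p = 2` (`r ≤ 6`?), and `p ≥ 1` cannot be discharged before `stub_leftConstBound`'s method
  exists.  Likewise `p = 0, q ≥ 1, ρ = 4` contains the mixed class `(p', q) = (4, q)` with the
  `H₁`-part confined to a `10`-dimensional space (core `C(X) = [A(X); 0]`, `A(X)` a free `4 × 10`
  block), i.e. `stub_mixedDeepBound`'s territory; only the pure-core case is reachable today.
-/

set_option linter.dupNamespace false

namespace Summit.MatrixMultiplication.MatrixMultiplication.Cruxes.HiddenCornerLemmaR.AtkinsonLloydCoreSplit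

open Matrix
open Summit.MatrixMultiplication.MatrixMultiplication.Theorems (hclR_hconst_bound hclR_eq_zero_of_stein)

/-- **Case `p = 0`, `n₀ ≤ 2ρ + q`** of `stub_coreClassBound` (the stub's exact binders, two extra
hypotheses in front).  With no left border rows the displacement is right-constant with the
`q + n₀` generators `[H₀ | Θ]` (`∇T a b = [G₁ a b | Γ C a b] · [H₀ | Θ]ᵀ`), so the landed
H-constant lemma `hclR_hconst_bound` gives `r ≤ q + n₀ ≤ 2(q + ρ)`. -/
theorem coreClassBound_p_zero_of_le :
    ∀ (r N p q ρ m₀ n₀ : ℕ) (T : Fin r → Fin r → Matrix (Fin N) (Fin N) ℂ) (E F : Matrix (Fin N) (Fin r) ℂ)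
    (G₀ : Matrix (Fin N) (Fin p) ℂ) (H₀ : Matrix (Fin N) (Fin q) ℂ)
    (Γ : Matrix (Fin N) (Fin m₀) ℂ) (Θ : Matrix (Fin N) (Fin n₀) ℂ)
    (H₁ : Fin r → Fin r → Matrix (Fin N) (Fin p) ℂ) (G₁ : Fin r → Fin r → Matrix (Fin N) (Fin q) ℂ)
    (C : Fin r → Fin r → Matrix (Fin m₀) (Fin n₀) ℂ),
    p = 0 → n₀ ≤ 2 * ρ + q →
    0 < m₀ → 0 < n₀ → 2 * m₀ ≤ ρ * (ρ + 1) → 2 * n₀ ≤ ρ * (ρ + 1) →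
    E.rank = r → F.rank = r →
    (Matrix.fromCols G₀ Γ).rank = p + m₀ → (Matrix.fromCols H₀ Θ).rank = q + n₀ →
    (∀ X : Matrix (Fin r) (Fin r) ℂ, (∑ a : Fin r, ∑ b : Fin r, X a b • C a b).rank ≤ ρ) →
    (∀ X : Matrix (Fin r) (Fin r) ℂ, (∑ a : Fin r, ∑ b : Fin r, X a b • T a b) * E = F * X) →
    (∀ a b, T a b - (Matrix.of fun i j : Fin N => if (i : ℕ) = (j : ℕ) + 1 then (1 : ℂ) else 0) * T a b * (Matrix.of fun i j : Fin N => if (i : ℕ) = (j : ℕ) + 1 then (1 : ℂ) else 0)ᵀ = G₀ * (H₁ a b)ᵀ + G₁ a b * H₀ᵀ + Γ * C a b * Θᵀ) →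
    (∃ X₀ : Matrix (Fin r) (Fin r) ℂ, (∑ a : Fin r, ∑ b : Fin r, X₀ a b • T a b).det ≠ 0) →
    (∀ c : ℕ, (∀ i : Fin N, (i : ℕ) < c → (∀ k : Fin p, G₀ i k = 0) ∧ (∀ k : Fin m₀, Γ i k = 0)) →
      ∀ (a : Fin r) (i : Fin N), (i : ℕ) < c → F i a = 0) →
    r ≤ 2 * (p + q + ρ) := by
  intro r N p q ρ m₀ n₀ T E F G₀ H₀ Γ Θ H₁ G₁ C hp hle _hm _hn _hm₀ _hn₀ _hE hF _hGΓ _hHΘ _hrkC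
    hcorner hdsp _hns _hdeep
  subst hp
  rcases Nat.eq_zero_or_pos r with hr | hr
  · omega
  have hFne : F ≠ 0 := by rintro rfl; rw [Matrix.rank_zero] at hF; omega
  set H₀' : Matrix (Fin N) (Fin (q + n₀)) ℂ := (Matrix.fromCols H₀ Θ).submatrix id finSumFinEquiv.symm with hH₀'
  set G' : Fin r → Fin r → Matrix (Fin N) (Fin (q + n₀)) ℂ := fun a b =>
    (Matrix.fromCols (G₁ a b) (Γ * C a b)).submatrix id finSumFinEquiv.symm with hG'
  have hdsp' : ∀ a b, T a b - (Matrix.of fun i j : Fin N => if (i : ℕ) = (j : ℕ) + 1 then (1 : ℂ) else 0) * T a b * (Matrix.of fun i j : Fin N => if (i : ℕ) = (j : ℕ) + 1 then (1 : ℂ) else 0)ᵀ = G' a b * H₀'ᵀ := by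
    intro a b
    have h0 : G₀ * (H₁ a b)ᵀ = 0 := by ext i j; simp [Matrix.mul_apply]
    rw [hdsp a b, h0, zero_add, hG', hH₀', Matrix.transpose_submatrix, Matrix.submatrix_mul_equiv,
      Matrix.transpose_fromCols, Matrix.fromCols_mul_fromRows, Matrix.submatrix_id_id, Matrix.mul_assoc]
  have h := hclR_hconst_bound r N (q + n₀) T E F H₀' G' hFne hcorner hdsp'
  omega

/-- **Case `p = 0`, `ρ ≤ 3`** of `stub_coreClassBound` (exact binders, two extra hypotheses in
front): Atkinson's bound `2 n₀ ≤ ρ(ρ+1) ≤ 4ρ` for `ρ ≤ 3` feeds `coreClassBound_p_zero_of_le`. -/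
theorem coreClassBound_p_zero_rho_le_three :
    ∀ (r N p q ρ m₀ n₀ : ℕ) (T : Fin r → Fin r → Matrix (Fin N) (Fin N) ℂ) (E F : Matrix (Fin N) (Fin r) ℂ)
    (G₀ : Matrix (Fin N) (Fin p) ℂ) (H₀ : Matrix (Fin N) (Fin q) ℂ)
    (Γ : Matrix (Fin N) (Fin m₀) ℂ) (Θ : Matrix (Fin N) (Fin n₀) ℂ)
    (H₁ : Fin r → Fin r → Matrix (Fin N) (Fin p) ℂ) (G₁ : Fin r → Fin r → Matrix (Fin N) (Fin q) ℂ)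
    (C : Fin r → Fin r → Matrix (Fin m₀) (Fin n₀) ℂ),
    p = 0 → ρ ≤ 3 →
    0 < m₀ → 0 < n₀ → 2 * m₀ ≤ ρ * (ρ + 1) → 2 * n₀ ≤ ρ * (ρ + 1) →
    E.rank = r → F.rank = r →
    (Matrix.fromCols G₀ Γ).rank = p + m₀ → (Matrix.fromCols H₀ Θ).rank = q + n₀ →
    (∀ X : Matrix (Fin r) (Fin r) ℂ, (∑ a : Fin r, ∑ b : Fin r, X a b • C a b).rank ≤ ρ) →
    (∀ X : Matrix (Fin r) (Fin r) ℂ, (∑ a : Fin r, ∑ b : Fin r, X a b • T a b) * E = F * X) →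
    (∀ a b, T a b - (Matrix.of fun i j : Fin N => if (i : ℕ) = (j : ℕ) + 1 then (1 : ℂ) else 0) * T a b * (Matrix.of fun i j : Fin N => if (i : ℕ) = (j : ℕ) + 1 then (1 : ℂ) else 0)ᵀ = G₀ * (H₁ a b)ᵀ + G₁ a b * H₀ᵀ + Γ * C a b * Θᵀ) →
    (∃ X₀ : Matrix (Fin r) (Fin r) ℂ, (∑ a : Fin r, ∑ b : Fin r, X₀ a b • T a b).det ≠ 0) →
    (∀ c : ℕ, (∀ i : Fin N, (i : ℕ) < c → (∀ k : Fin p, G₀ i k = 0) ∧ (∀ k : Fin m₀, Γ i k = 0)) →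
      ∀ (a : Fin r) (i : Fin N), (i : ℕ) < c → F i a = 0) →
    r ≤ 2 * (p + q + ρ) := by
  intro r N p q ρ m₀ n₀ T E F G₀ H₀ Γ Θ H₁ G₁ C hp hρ hm hn hm₀ hn₀ hE hF hGΓ hHΘ hrkC hcorner hdsp
    hns hdeep
  have hle : n₀ ≤ 2 * ρ + q := by interval_cases ρ <;> omega
  exact coreClassBound_p_zero_of_le r N p q ρ m₀ n₀ T E F G₀ H₀ Γ Θ H₁ G₁ C hp hle hm hn hm₀ hn₀ hE
    hF hGΓ hHΘ hrkC hcorner hdsp hns hdeep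


/-! ## Pure cores (`p = q = 0`): the Flanders count -/

/-- Stein displacement is linear in the pencil variable (copy of the skeleton's `stein_pencil`). -/
theorem core_stein_pencil (r N : ℕ) (T : Fin r → Fin r → Matrix (Fin N) (Fin N) ℂ)
    (X : Matrix (Fin r) (Fin r) ℂ) :
    (∑ a : Fin r, ∑ b : Fin r, X a b • T a b) - (Matrix.of fun i j : Fin N => if (i : ℕ) = (j : ℕ) + 1 then (1 : ℂ) else 0) * (∑ a : Fin r, ∑ b : Fin r, X a b • T a b) * (Matrix.of fun i j : Fin N => if (i : ℕ) = (j : ℕ) + 1 then (1 : ℂ) else 0)ᵀ =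
      ∑ a : Fin r, ∑ b : Fin r, X a b • (T a b - (Matrix.of fun i j : Fin N => if (i : ℕ) = (j : ℕ) + 1 then (1 : ℂ) else 0) * T a b * (Matrix.of fun i j : Fin N => if (i : ℕ) = (j : ℕ) + 1 then (1 : ℂ) else 0)ᵀ) := by
  simp only [smul_sub, Finset.sum_sub_distrib, Finset.mul_sum, Finset.sum_mul, Matrix.mul_smul,
    Matrix.smul_mul]

/-- A matrix whose rank equals its number of columns has linearly independent columns. -/
theorem core_linearIndependent_col_of_rank {N p : ℕ} (G : Matrix (Fin N) (Fin p) ℂ)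
    (hG : G.rank = p) : LinearIndependent ℂ G.col := by
  rw [linearIndependent_iff_card_eq_finrank_span, Set.finrank, ← Matrix.rank_eq_finrank_span_cols,
    hG, Fintype.card_fin]

/-- A matrix of full column rank is left-cancellable: `rank F = r` and `F * X = 0` force `X = 0`. -/
theorem core_eq_zero_of_mul_eq_zero {N r : ℕ} {κ : Type*} (F : Matrix (Fin N) (Fin r) ℂ)
    (hF : F.rank = r) (X : Matrix (Fin r) κ ℂ) (h : F * X = 0) : X = 0 := by
  have hinj : Function.Injective F.mulVec :=
    Matrix.mulVec_injective_iff.mpr (core_linearIndependent_col_of_rank F hF)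
  ext k j
  have hcol : F *ᵥ (fun k => X k j) = F *ᵥ 0 := by
    rw [Matrix.mulVec_zero]
    funext i
    have hij := congrFun (congrFun h i) j
    rw [Matrix.mul_apply] at hij
    simpa [Matrix.mulVec, dotProduct] using hij
  exact congrFun (hinj hcol) k

/-- **Pure cores — the Flanders count.** If every `∇T a b = Γ (C a b) Θᵀ` (no border rows or
columns), the corner `T(X) E = F X` has `rank F = r`, and `rank C(X) ≤ ρ` for all `X`, then
`r² ≤ ρ · max(m₀, n₀)`.  Indeed `X ↦ C(X)` is injective (`C(X) = 0 ⟹ ∇T(X) = 0 ⟹ T(X) = 0`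
by Stein uniqueness `hclR_eq_zero_of_stein` `⟹ F X = 0 ⟹ X = 0`), so `{C(X)}` is an
`r²`-dimensional space of `m₀ × n₀` matrices of rank `≤ ρ`, whose dimension Flanders' theorem
(`Literature.LinearAlgebra.Matrix.finrank_le_of_forall_rank_le`, Flanders 1962) bounds by
`ρ · max(m₀, n₀)`.  (No hypothesis on `E`, `Γ`, `Θ`, no nonsingularity.) -/
theorem core_pure_sq_le (r N ρ m₀ n₀ : ℕ) (T : Fin r → Fin r → Matrix (Fin N) (Fin N) ℂ)
    (E F : Matrix (Fin N) (Fin r) ℂ) (Γ : Matrix (Fin N) (Fin m₀) ℂ) (Θ : Matrix (Fin N) (Fin n₀) ℂ)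
    (C : Fin r → Fin r → Matrix (Fin m₀) (Fin n₀) ℂ) (hF : F.rank = r)
    (hrkC : ∀ X : Matrix (Fin r) (Fin r) ℂ, (∑ a : Fin r, ∑ b : Fin r, X a b • C a b).rank ≤ ρ)
    (hcorner : ∀ X : Matrix (Fin r) (Fin r) ℂ, (∑ a : Fin r, ∑ b : Fin r, X a b • T a b) * E = F * X)
    (hdsp : ∀ a b, T a b - (Matrix.of fun i j : Fin N => if (i : ℕ) = (j : ℕ) + 1 then (1 : ℂ) else 0) * T a b *
      (Matrix.of fun i j : Fin N => if (i : ℕ) = (j : ℕ) + 1 then (1 : ℂ) else 0)ᵀ = Γ * C a b * Θᵀ) :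
    r * r ≤ ρ * max m₀ n₀ := by
  -- injectivity of `X ↦ C(X)`
  have hinj : ∀ X : Matrix (Fin r) (Fin r) ℂ, (∑ a : Fin r, ∑ b : Fin r, X a b • C a b) = 0 → X = 0 := by
    intro X hX
    set M : Matrix (Fin N) (Fin N) ℂ := ∑ a : Fin r, ∑ b : Fin r, X a b • T a b with hM
    have hdispX : M - (Matrix.of fun i j : Fin N => if (i : ℕ) = (j : ℕ) + 1 then (1 : ℂ) else 0) * M *
        (Matrix.of fun i j : Fin N => if (i : ℕ) = (j : ℕ) + 1 then (1 : ℂ) else 0)ᵀ = 0 := by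
      rw [hM, core_stein_pencil]
      simp only [hdsp]
      calc (∑ a : Fin r, ∑ b : Fin r, X a b • (Γ * C a b * Θᵀ))
          = Γ * (∑ a : Fin r, ∑ b : Fin r, X a b • C a b) * Θᵀ := by
            simp only [Matrix.mul_sum, Matrix.sum_mul, Matrix.mul_smul, Matrix.smul_mul]
        _ = 0 := by rw [hX, Matrix.mul_zero, Matrix.zero_mul]
    have hM0 : M = 0 := hclR_eq_zero_of_stein M (sub_eq_zero.mp hdispX)
    have hFX : F * X = 0 := by rw [← hcorner X, ← hM, hM0, Matrix.zero_mul]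
    exact core_eq_zero_of_mul_eq_zero F hF X hFX
  -- the core space and its dimension
  set v : Fin r × Fin r → Matrix (Fin m₀) (Fin n₀) ℂ := fun ab => C ab.1 ab.2 with hv
  have hli : LinearIndependent ℂ v := by
    rw [Fintype.linearIndependent_iff]
    intro g hg ab
    have hsum : (∑ a : Fin r, ∑ b : Fin r, (Matrix.of fun a b => g (a, b)) a b • C a b) = 0 := by
      rw [← hg, Fintype.sum_prod_type]
      rfl
    have h0 := hinj _ hsum
    have := congrFun (congrFun h0 ab.1) ab.2
    simpa using this
  set W : Submodule ℂ (Matrix (Fin m₀) (Fin n₀) ℂ) := Submodule.span ℂ (Set.range v) with hW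
  have hWdim : Module.finrank ℂ W = r * r := by
    rw [hW, finrank_span_eq_card hli, Fintype.card_prod, Fintype.card_fin]
  have hWrk : ∀ A ∈ W, A.rank ≤ ρ := by
    intro A hA
    rw [hW, Submodule.mem_span_range_iff_exists_fun] at hA
    obtain ⟨c, rfl⟩ := hA
    have h := hrkC (Matrix.of fun a b => c (a, b))
    rw [Fintype.sum_prod_type]
    simpa using h
  haveI : Infinite ℂ := CharZero.infinite ℂ
  have hFl := Literature.LinearAlgebra.Matrix.finrank_le_of_forall_rank_le W ρ hWrk
  rw [hWdim, Fintype.card_fin, Fintype.card_fin] at hFl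
  exact hFl

/-- Arithmetic of the pure-core case: `r² ≤ ρ M`, `2M ≤ ρ(ρ+1)`, `ρ ≤ 8` give `r ≤ 2ρ`
(`ρ²(ρ+1)/2 < (2ρ+1)²` exactly for `ρ ≤ 8`). -/
theorem core_arith {r ρ M : ℕ} (hρ : ρ ≤ 8) (h : r * r ≤ ρ * M) (hM : 2 * M ≤ ρ * (ρ + 1)) :
    r ≤ 2 * ρ := by
  have key : r * r < (2 * ρ + 1) * (2 * ρ + 1) := by
    interval_cases ρ <;> omega
  have := Nat.mul_self_lt_mul_self_iff.mp key
  omega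

/-- **Case `p = q = 0` (pure core), `ρ ≤ 8`** of `stub_coreClassBound` (exact binders, three extra
hypotheses in front).  By `core_pure_sq_le`, `r² ≤ ρ · max(m₀, n₀) ≤ ρ²(ρ+1)/2` (Atkinson's size
bound), and `ρ²(ρ+1)/2 < (2ρ+1)²` for `ρ ≤ 8`, so `r ≤ 2ρ`.  This settles every pure core of
Stein displacement rank `d = ρ ≤ 8` (the H-constant count alone stops at `ρ = 3`); for `ρ ≥ 9`
the count allows `r = 20 > 18` and structure beyond Flanders' bound is needed. -/
theorem coreClassBound_pq_zero_rho_le_eight :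
    ∀ (r N p q ρ m₀ n₀ : ℕ) (T : Fin r → Fin r → Matrix (Fin N) (Fin N) ℂ) (E F : Matrix (Fin N) (Fin r) ℂ)
    (G₀ : Matrix (Fin N) (Fin p) ℂ) (H₀ : Matrix (Fin N) (Fin q) ℂ)
    (Γ : Matrix (Fin N) (Fin m₀) ℂ) (Θ : Matrix (Fin N) (Fin n₀) ℂ)
    (H₁ : Fin r → Fin r → Matrix (Fin N) (Fin p) ℂ) (G₁ : Fin r → Fin r → Matrix (Fin N) (Fin q) ℂ)
    (C : Fin r → Fin r → Matrix (Fin m₀) (Fin n₀) ℂ),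
    p = 0 → q = 0 → ρ ≤ 8 →
    0 < m₀ → 0 < n₀ → 2 * m₀ ≤ ρ * (ρ + 1) → 2 * n₀ ≤ ρ * (ρ + 1) →
    E.rank = r → F.rank = r →
    (Matrix.fromCols G₀ Γ).rank = p + m₀ → (Matrix.fromCols H₀ Θ).rank = q + n₀ →
    (∀ X : Matrix (Fin r) (Fin r) ℂ, (∑ a : Fin r, ∑ b : Fin r, X a b • C a b).rank ≤ ρ) →
    (∀ X : Matrix (Fin r) (Fin r) ℂ, (∑ a : Fin r, ∑ b : Fin r, X a b • T a b) * E = F * X) →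
    (∀ a b, T a b - (Matrix.of fun i j : Fin N => if (i : ℕ) = (j : ℕ) + 1 then (1 : ℂ) else 0) * T a b * (Matrix.of fun i j : Fin N => if (i : ℕ) = (j : ℕ) + 1 then (1 : ℂ) else 0)ᵀ = G₀ * (H₁ a b)ᵀ + G₁ a b * H₀ᵀ + Γ * C a b * Θᵀ) →
    (∃ X₀ : Matrix (Fin r) (Fin r) ℂ, (∑ a : Fin r, ∑ b : Fin r, X₀ a b • T a b).det ≠ 0) →
    (∀ c : ℕ, (∀ i : Fin N, (i : ℕ) < c → (∀ k : Fin p, G₀ i k = 0) ∧ (∀ k : Fin m₀, Γ i k = 0)) →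
      ∀ (a : Fin r) (i : Fin N), (i : ℕ) < c → F i a = 0) →
    r ≤ 2 * (p + q + ρ) := by
  intro r N p q ρ m₀ n₀ T E F G₀ H₀ Γ Θ H₁ G₁ C hp hq hρ _hm _hn hm₀ hn₀ _hE hF _hGΓ _hHΘ hrkC
    hcorner hdsp _hns _hdeep
  subst hp
  subst hq
  have hdsp' : ∀ a b, T a b - (Matrix.of fun i j : Fin N => if (i : ℕ) = (j : ℕ) + 1 then (1 : ℂ) else 0) * T a b *
      (Matrix.of fun i j : Fin N => if (i : ℕ) = (j : ℕ) + 1 then (1 : ℂ) else 0)ᵀ = Γ * C a b * Θᵀ := by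
    intro a b
    have h0 : G₀ * (H₁ a b)ᵀ = 0 := by ext i j; simp [Matrix.mul_apply]
    have h1 : G₁ a b * H₀ᵀ = 0 := by ext i j; simp [Matrix.mul_apply]
    rw [hdsp a b, h0, h1, zero_add, zero_add]
  have hsq := core_pure_sq_le r N ρ m₀ n₀ T E F Γ Θ C hF hrkC hcorner hdsp'
  have hM : 2 * max m₀ n₀ ≤ ρ * (ρ + 1) := by
    rcases le_total m₀ n₀ with h | h
    · rw [max_eq_right h]; exact hn₀
    · rw [max_eq_left h]; exact hm₀
  have := core_arith hρ hsq hM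
  omega


/-- **Case `p = 0`, rank budget `q + ρ ≤ 4`** of `stub_coreClassBound` (exact binders, two extra
hypotheses in front): every core class WITHOUT left border rows of total displacement rank
`d = q + ρ ≤ 4` satisfies the stub — `q = 0` is the pure core (`ρ ≤ 4 ≤ 8`,
`coreClassBound_pq_zero_rho_le_eight`), `q ≥ 1` forces `ρ ≤ 3` (`coreClassBound_p_zero_rho_le_three`).
The first `p = 0` instance left open is `(q, ρ, n₀) = (1, 4, 10)` (`r ≤ 11` known, `r ≤ 10` wanted). -/
theorem coreClassBound_p_zero_budget_le_four :
    ∀ (r N p q ρ m₀ n₀ : ℕ) (T : Fin r → Fin r → Matrix (Fin N) (Fin N) ℂ) (E F : Matrix (Fin N) (Fin r) ℂ)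
    (G₀ : Matrix (Fin N) (Fin p) ℂ) (H₀ : Matrix (Fin N) (Fin q) ℂ)
    (Γ : Matrix (Fin N) (Fin m₀) ℂ) (Θ : Matrix (Fin N) (Fin n₀) ℂ)
    (H₁ : Fin r → Fin r → Matrix (Fin N) (Fin p) ℂ) (G₁ : Fin r → Fin r → Matrix (Fin N) (Fin q) ℂ)
    (C : Fin r → Fin r → Matrix (Fin m₀) (Fin n₀) ℂ),
    p = 0 → q + ρ ≤ 4 →
    0 < m₀ → 0 < n₀ → 2 * m₀ ≤ ρ * (ρ + 1) → 2 * n₀ ≤ ρ * (ρ + 1) →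
    E.rank = r → F.rank = r →
    (Matrix.fromCols G₀ Γ).rank = p + m₀ → (Matrix.fromCols H₀ Θ).rank = q + n₀ →
    (∀ X : Matrix (Fin r) (Fin r) ℂ, (∑ a : Fin r, ∑ b : Fin r, X a b • C a b).rank ≤ ρ) →
    (∀ X : Matrix (Fin r) (Fin r) ℂ, (∑ a : Fin r, ∑ b : Fin r, X a b • T a b) * E = F * X) →
    (∀ a b, T a b - (Matrix.of fun i j : Fin N => if (i : ℕ) = (j : ℕ) + 1 then (1 : ℂ) else 0) * T a b * (Matrix.of fun i j : Fin N => if (i : ℕ) = (j : ℕ) + 1 then (1 : ℂ) else 0)ᵀ = G₀ * (H₁ a b)ᵀ + G₁ a b * H₀ᵀ + Γ * C a b * Θᵀ) →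
    (∃ X₀ : Matrix (Fin r) (Fin r) ℂ, (∑ a : Fin r, ∑ b : Fin r, X₀ a b • T a b).det ≠ 0) →
    (∀ c : ℕ, (∀ i : Fin N, (i : ℕ) < c → (∀ k : Fin p, G₀ i k = 0) ∧ (∀ k : Fin m₀, Γ i k = 0)) →
      ∀ (a : Fin r) (i : Fin N), (i : ℕ) < c → F i a = 0) →
    r ≤ 2 * (p + q + ρ) := by
  intro r N p q ρ m₀ n₀ T E F G₀ H₀ Γ Θ H₁ G₁ C hp hbud hm hn hm₀ hn₀ hE hF hGΓ hHΘ hrkC hcorner hdsp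
    hns hdeep
  rcases Nat.eq_zero_or_pos q with hq | hq
  · exact coreClassBound_pq_zero_rho_le_eight r N p q ρ m₀ n₀ T E F G₀ H₀ Γ Θ H₁ G₁ C hp hq (by omega)
      hm hn hm₀ hn₀ hE hF hGΓ hHΘ hrkC hcorner hdsp hns hdeep
  · exact coreClassBound_p_zero_rho_le_three r N p q ρ m₀ n₀ T E F G₀ H₀ Γ Θ H₁ G₁ C hp (by omega)
      hm hn hm₀ hn₀ hE hF hGΓ hHΘ hrkC hcorner hdsp hns hdeep

/-! ## Why the stub is blocked: it contains the G-constant law up to `+2` -/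

/-- Rank of `[G₀ | γ]` for a column `γ` outside the column span of a full-column-rank `G₀`. -/
theorem core_rank_fromCols_col {N p : ℕ} (G₀ : Matrix (Fin N) (Fin p) ℂ) (hG₀ : G₀.rank = p)
    (γ : Fin N → ℂ) (hγ : γ ∉ Submodule.span ℂ (Set.range G₀.col)) :
    (Matrix.fromCols G₀ (Matrix.of fun i (_ : Fin 1) => γ i)).rank = p + 1 := by
  have hγ0 : γ ≠ 0 := by rintro rfl; exact hγ (Submodule.zero_mem _)
  have hcol : (Matrix.fromCols G₀ (Matrix.of fun i (_ : Fin 1) => γ i)).col =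
      Sum.elim G₀.col (fun _ : Fin 1 => γ) := by
    funext j
    rcases j with k | k
    · funext i
      simp [Matrix.col_apply]
    · funext i
      simp [Matrix.col_apply]
  have hli : LinearIndependent ℂ (Sum.elim G₀.col (fun _ : Fin 1 => γ)) := by
    refine (core_linearIndependent_col_of_rank G₀ hG₀).sum_type
      (linearIndependent_unique_iff.mpr hγ0) ?_
    rw [Set.range_const]
    exact (Submodule.disjoint_span_singleton' hγ0).mpr hγ
  rw [Matrix.rank_eq_finrank_span_cols, hcol, finrank_span_eq_card hli, Fintype.card_sum,
    Fintype.card_fin, Fintype.card_fin]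

/-- **The stub contains the G-constant law up to `+2`.**  The statement of `stub_coreClassBound`
implies the statement of the neighbouring stub `stub_leftConstBound` with conclusion `r ≤ 2p + 2`
in place of `r ≤ 2p`: a left-constant pencil `∇T a b = G₀ (H₁ a b)ᵀ` is a core-split pencil with
`q = 0`, `ρ = m₀ = n₀ = 1`, core coefficients `C ≡ 0`, `H₀`, `G₁` empty, `Θ = e₀`, and `Γ = γ` any
column outside the column span of `G₀` with `γ 0 ≠ 0` (it exists as soon as `p < N`; for `p ≥ N`
the bound `r ≤ N ≤ p` is trivial): then `[G₀ | γ]` and `[∅ | e₀]` have full column rank, the rank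
budget `rank C(X) = 0 ≤ 1` and Atkinson's size bounds hold, and the deep hypothesis is VACUOUS
because row `0` of `Γ` is nonzero.  Hence the stub is open wherever "`r ≤ 2p + 2` in the
left-constant class" is open (first instance `p = 2`, `r = 7`; the landed strip theorem needs strip
generators), and no proof of the stub can bypass the method that settles `stub_leftConstBound`. -/
theorem leftConstBound_add_two_of_coreClassBound
    (h₅ : ∀ (r N p q ρ m₀ n₀ : ℕ) (T : Fin r → Fin r → Matrix (Fin N) (Fin N) ℂ) (E F : Matrix (Fin N) (Fin r) ℂ)
      (G₀ : Matrix (Fin N) (Fin p) ℂ) (H₀ : Matrix (Fin N) (Fin q) ℂ)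
      (Γ : Matrix (Fin N) (Fin m₀) ℂ) (Θ : Matrix (Fin N) (Fin n₀) ℂ)
      (H₁ : Fin r → Fin r → Matrix (Fin N) (Fin p) ℂ) (G₁ : Fin r → Fin r → Matrix (Fin N) (Fin q) ℂ)
      (C : Fin r → Fin r → Matrix (Fin m₀) (Fin n₀) ℂ),
      0 < m₀ → 0 < n₀ → 2 * m₀ ≤ ρ * (ρ + 1) → 2 * n₀ ≤ ρ * (ρ + 1) →
      E.rank = r → F.rank = r →
      (Matrix.fromCols G₀ Γ).rank = p + m₀ → (Matrix.fromCols H₀ Θ).rank = q + n₀ →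
      (∀ X : Matrix (Fin r) (Fin r) ℂ, (∑ a : Fin r, ∑ b : Fin r, X a b • C a b).rank ≤ ρ) →
      (∀ X : Matrix (Fin r) (Fin r) ℂ, (∑ a : Fin r, ∑ b : Fin r, X a b • T a b) * E = F * X) →
      (∀ a b, T a b - (Matrix.of fun i j : Fin N => if (i : ℕ) = (j : ℕ) + 1 then (1 : ℂ) else 0) * T a b * (Matrix.of fun i j : Fin N => if (i : ℕ) = (j : ℕ) + 1 then (1 : ℂ) else 0)ᵀ = G₀ * (H₁ a b)ᵀ + G₁ a b * H₀ᵀ + Γ * C a b * Θᵀ) →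
      (∃ X₀ : Matrix (Fin r) (Fin r) ℂ, (∑ a : Fin r, ∑ b : Fin r, X₀ a b • T a b).det ≠ 0) →
      (∀ c : ℕ, (∀ i : Fin N, (i : ℕ) < c → (∀ k : Fin p, G₀ i k = 0) ∧ (∀ k : Fin m₀, Γ i k = 0)) →
        ∀ (a : Fin r) (i : Fin N), (i : ℕ) < c → F i a = 0) →
      r ≤ 2 * (p + q + ρ)) :
    ∀ (r N p : ℕ) (T : Fin r → Fin r → Matrix (Fin N) (Fin N) ℂ) (E F : Matrix (Fin N) (Fin r) ℂ)
    (G₀ : Matrix (Fin N) (Fin p) ℂ) (H₁ : Fin r → Fin r → Matrix (Fin N) (Fin p) ℂ),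
    E.rank = r → F.rank = r → G₀.rank = p →
    (∀ X : Matrix (Fin r) (Fin r) ℂ, (∑ a : Fin r, ∑ b : Fin r, X a b • T a b) * E = F * X) →
    (∀ a b, T a b - (Matrix.of fun i j : Fin N => if (i : ℕ) = (j : ℕ) + 1 then (1 : ℂ) else 0) * T a b * (Matrix.of fun i j : Fin N => if (i : ℕ) = (j : ℕ) + 1 then (1 : ℂ) else 0)ᵀ = G₀ * (H₁ a b)ᵀ) →
    (∃ X₀ : Matrix (Fin r) (Fin r) ℂ, (∑ a : Fin r, ∑ b : Fin r, X₀ a b • T a b).det ≠ 0) →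
    r ≤ 2 * p + 2 := by
  intro r N p T E F G₀ H₁ hE hF hG₀ hcorner hdsp hns
  -- trivial when `p ≥ N`
  rcases le_or_gt N p with hNp | hpN
  · have := Matrix.rank_le_height E
    omega
  have hN : 0 < N := by omega
  -- a column outside the column span of `G₀` whose entry `0` is nonzero
  set S : Submodule ℂ (Fin N → ℂ) := Submodule.span ℂ (Set.range G₀.col) with hS
  have hSdim : Module.finrank ℂ S = p := by
    rw [hS, ← Matrix.rank_eq_finrank_span_cols, hG₀]
  obtain ⟨γ', -, hγ'⟩ : ∃ x ∈ (⊤ : Submodule ℂ (Fin N → ℂ)), x ∉ S :=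
    SetLike.exists_of_lt (Submodule.lt_top_of_finrank_lt_finrank (by
      rw [hSdim, Module.finrank_fin_fun ℂ]; exact hpN))
  set e₀ : Fin N → ℂ := Pi.single (⟨0, hN⟩ : Fin N) 1 with he₀
  have he₀0 : e₀ ⟨0, hN⟩ = 1 := by rw [he₀, Pi.single_eq_same]
  obtain ⟨γ, hγS, hγ0⟩ : ∃ γ : Fin N → ℂ, γ ∉ S ∧ γ ⟨0, hN⟩ ≠ 0 := by
    by_cases h0 : e₀ ∈ S
    · by_cases h1 : γ' ⟨0, hN⟩ = 0
      · refine ⟨γ' + e₀, fun h => hγ' ?_, ?_⟩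
        · have := S.sub_mem h h0
          rwa [add_sub_cancel_right] at this
        · rw [Pi.add_apply, h1, he₀0, zero_add]
          exact one_ne_zero
      · exact ⟨γ', hγ', h1⟩
    · refine ⟨e₀, h0, ?_⟩
      rw [he₀0]
      exact one_ne_zero
  -- the core-split data: `q = 0`, `ρ = m₀ = n₀ = 1`, `C ≡ 0`, `Γ = γ`, `Θ = e₀`
  set Γ : Matrix (Fin N) (Fin 1) ℂ := Matrix.of fun i _ => γ i with hΓ
  set Θ : Matrix (Fin N) (Fin 1) ℂ := Matrix.of fun i _ => e₀ i with hΘ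
  have hGΓ : (Matrix.fromCols G₀ Γ).rank = p + 1 := core_rank_fromCols_col G₀ hG₀ γ hγS
  have hHΘ : (Matrix.fromCols (0 : Matrix (Fin N) (Fin 0) ℂ) Θ).rank = 0 + 1 := by
    refine core_rank_fromCols_col (0 : Matrix (Fin N) (Fin 0) ℂ) Matrix.rank_zero e₀ ?_
    have hrange : Set.range (0 : Matrix (Fin N) (Fin 0) ℂ).col = ∅ := Set.range_eq_empty _
    rw [hrange, Submodule.span_empty, Submodule.mem_bot]
    intro h
    have := congrFun h ⟨0, hN⟩
    rw [he₀0] at this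
    exact one_ne_zero this
  have h := h₅ r N p 0 1 1 1 T E F G₀ (0 : Matrix (Fin N) (Fin 0) ℂ) Γ Θ H₁ (fun _ _ => 0)
    (fun _ _ => 0) Nat.one_pos Nat.one_pos (by norm_num) (by norm_num) hE hF hGΓ hHΘ ?_ hcorner ?_
    hns ?_
  · omega
  · intro X
    simp
  · intro a b
    rw [hdsp a b]
    simp
  · intro c hc a i hi
    exfalso
    have h0c : ((⟨0, hN⟩ : Fin N) : ℕ) < c := by
      show 0 < c
      omega
    have := (hc ⟨0, hN⟩ h0c).2 0
    rw [hΓ, Matrix.of_apply] at this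
    exact hγ0 this

end Summit.MatrixMultiplication.MatrixMultiplication.Cruxes.HiddenCornerLemmaR.AtkinsonLloydCoreSplit
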